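import Summits.QuantumFields.YangMills.Theorems.BalabanUVNodesN09CentralWindowForwardLawAtRecord
import Summits.QuantumFields.YangMills.Theorems.BalabanUVNodesN09TowerOfPerBondChartsOfWindowOpenness

/-!
# NODE N09 [B12] — THE CHART JACOBIANS OF THE ONE-BOND (0.4) AVERAGES ARE JOINTLY CONTINUOUS ON THE WINDOW GRAPH; the `jac`-letters of road A′'s tower at the record, supplied

Cell `pub-ymgap` (YM-PLAN Track A), width seat `pub-ymgap-dag-n09-w6` g4, FILE 9 (OFFER∕CLAIM-8 bus I.38533, first refusal to the dag-n09-w4 lineage); helper of K1⁹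
`StabilityBRunRowsAtRecordR13SepCoPHV` = stmt-QuantumFields-27364 (`--supports`, `--as helper`, count-neutral).  [I] = [Balaban1987RG1] (CMP 109).

WHY.  dag-n09-w5 g5's `…N09TowerOfPerBondChartsOfWindowOpenness.hreg_pos_all_of_forwardLaws_of_openness` (p636542) runs road A′'s tower from FORWARD Jacobian laws and displays,
per level `j < K`, the Jacobian letters `jac hjacm hjaclb hjacc hfwd`.  dag-n09-w4 g5's `…N09CentralWindowForwardLawAtRecord.exists_jacobian_forwardLaws_continuousOn` supplies
`jac hjacm hjac0 hfwd hjacc` but hides `jac` behind `∃` with FIBREWISE continuity only, so the UNIFORM-in-`U` lower bound `hjaclb` cannot be derived by a consumer.  THIS FILE exports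
the missing clause: the same witness is JOINTLY continuous on the compact window graph `{(U, g) | g ∈ Ωα c U}` (§1–§2), whence `hjaclb` by dag-n09-w5's
`exists_pos_le_density_of_continuousOn_graph` (§3), and the four `jac`-letters + `hjaclb` are packaged at the record for all `j < K` (§3).

WHAT IS PROVED (theorems only; 0 `def`, 0 `instance`, 0 `sorry`).
§1 ★★ `continuousOn_jacobianFormula_graph` — the graph edition of `continuousOn_jacobian_toNNReal` (generic torus, `0 ≤ α`, `64·α ≤ δ_N`, off-central `i₀`).
§2 ★★★ `exists_jacobian_forwardLaws_continuousOn_graph` — FIVE clauses: `hjacm`, `hjac0`, `hfwd`, fibrewise `hjacc`, and `∀ c, ContinuousOn (fun p => jac c p.1 p.2) {(U,g) | g ∈ Ωα c U}`.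
§3 ★★★ `exists_jacobianLetters_record` — on the `K`-th torus, for `0 ≤ α ≤ 1∕24`, `64·α ≤ δ_N`, `157·α < L^{−(d−1)}` and the gap numerics `∀ j < K, ∀ c, offCard c∕|Idx| + 150·α < 1`:
   `∃ jac : ∀ j, PBond (F.P K) (j+1) → GaugeField (F.P K) j (SU N) → SU N → ℝ≥0` with, for all `j < K`: `hjacm` · `hjaclb` (`∃ m > 0`, uniform on the window graph) · `hjacc` · `hfwd` (with
   `(avOfRecord F N K j).avg`) — the `jac`-letters of `hreg_pos_all_of_forwardLaws_of_openness` VERBATIM.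

HONEST FRAMING.  Count-neutral kernel calculus ∕ topology BY NAME on landed files (dag-n09-w4 g5's 6b∕6c∕6d₁–6d₃, dag-n09-w5 g5's p636542); the §1–§2 proofs are dag-n09-w4's
fibrewise proofs with the environment letters made variables — nothing else; NOTHING of Bałaban's asserted; the smallness conditions on `α` and the gap numerics stay DISPLAYED; NO
window ∕ chart ∕ Jacobian of record re-pointed; dag-n09-w5's composition (their CLAIM-3) remains theirs; `hreg` ∕ N09 NOT discharged; conjunct 1 (Lemma 4) ∕ FLAG №7 untouched;
K0⁷ ∕ K1⁹ ∕ K3⁸ NOT closed; counts unmoved (typed 28∕28 · discharged 5∕28); one finite four-torus programme at fixed `ε = L^{−K}` per run — R4 closes the conditional rung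
`BalabanLadder.UV` only; NOT ℝ⁴ ∕ infinite volume ∕ OS; the Yang–Mills mass gap (Clay) is NOT proved by any of this.
-/

noncomputable section

open scoped Matrix.Norms.L2Operator Topology ContDiff ENNReal NNReal
open Filter Set Function MeasureTheory NormedSpace

namespace Summit.QuantumFields.YangMills.BalabanUVNodes.N09CentralWindowJacobianGraphContinuous

open Literature.MathematicalPhysics.QuantumFieldTheory.Balaban1983to89
open Literature.MathematicalPhysics.QuantumFieldTheory.Balaban1983to89.HaarExponentialChart
open Literature.MathematicalPhysics.QuantumFieldTheory.Balaban1983to89.HaarExponentialChart.IsChartRep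
open Literature.MathematicalPhysics.QuantumFieldTheory.Balaban1983to89.BlockAveraging (Small Idx avgFun loopHol instNonemptyIdx continuous_holAt)
open Literature.MathematicalPhysics.QuantumFieldTheory.Balaban1983to89.BlockAveragingHaarAC (centralBond pre post openHol IsCentral)
open Literature.MathematicalPhysics.QuantumFieldTheory.Balaban1983to89.BlockAveragingEMLHaarAC (fibreFamily fibreMap FibreSmall fibreGuard offCard
  fibreFamily_of_isCentral fibreMap_of_mem avgFun_update_centralBond_self map_haar_mul_mul coe_avg_expMeanLogSU)
open Literature.MathematicalPhysics.QuantumFieldTheory.Balaban1983to89.ExpMeanLog (eml expMeanLogSU deltaSU)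
open Literature.MathematicalPhysics.QuantumFieldTheory.Balaban1983to89.MatrixLog (mlog mlog_one)
open Literature.MathematicalPhysics.QuantumFieldTheory.Balaban1983to89.Node00
open Literature.MathematicalPhysics.QuantumFieldTheory.Balaban1983to89.T4Continuum (T4Family measurable_holAt)
open Literature.MathematicalPhysics.QuantumLattice (fundamentalRep fundamentalRep_apply)
open Summit.QuantumFields.YangMills.BalabanUVNodes.N09ForwardLawTools
open Summit.QuantumFields.YangMills.BalabanUVNodes.N09CentralWindowChart
open Summit.QuantumFields.YangMills.BalabanUVNodes.N09CentralWindowForwardLaw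
open Summit.QuantumFields.YangMills.BalabanUVNodes.N09CentralWindowNondegenerate
open Summit.QuantumFields.YangMills.BalabanUVNodes.N09CentralWindowForwardLawAtRecord
open Summit.QuantumFields.YangMills.BalabanUVNodes.N09TowerOfPerBondChartsOfWindowOpenness (exists_pos_le_density_of_continuousOn_graph)
open Summit.QuantumFields.YangMills.BalabanUVNodes.N09LiftInvariance29AtRecord (succ_le_range_of_lt)

variable {P : Params} {j : ℕ} {N : ℕ} [NeZero N]

/-! ## §1  Joint continuity of the chart Jacobian on the window graph -/

section Graph

/-- §1 ★★ **THE CHART JACOBIAN IS JOINTLY CONTINUOUS ON THE WINDOW GRAPH** — the graph edition of dag-n09-w4 g5's fibrewise `…N09CentralWindowForwardLawAtRecord.continuousOn_jacobian_toNNReal`: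
`(U, g) ↦ J(Φ(par(U), X(U,g)))·|det D_XΦ(par(U), X(U,g))|∕J(X(U,g))` (`X(U,g) = Λ(V_{i₀}(U)⁻¹·pre(U)·g·post(U))`, `par(U) = (V(U), V_{i₀}(U))`) is continuous on the graph
`{(U, g) | g ∈ Ωα c U}`: the three factors of the fibrewise proof, now with the environment letters `U ↦ V_i(U), pre(U), post(U)` continuous (`continuous_holAt`), `Λ` continuous on
its window, `Φ` and `DΦ` continuous at the analytic points (6b `contDiffAt_modelChart` is JOINT in `(par, X)`), `det` continuous.  `0 ≤ α`, `64·α ≤ δ_N`, `i₀` off-central.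
[cite: Balaban1987RG1, (0.4) p.253 and (2.10) p.267; Helgason2000, Ch. I §1 Thm. 1.14 (12)-(13) p. 96] -/
theorem continuousOn_jacobianFormula_graph (c : PBond P (j + 1)) {α : ℝ} (hα0 : 0 ≤ α) (hα64 : 64 * α ≤ deltaSU (Fin N))
    {i₀ : Idx P} (hi₀ : ¬ IsCentral c i₀)
    (EE : (Idx P → Matrix (Fin N) (Fin N) ℂ) → Matrix (Fin N) (Fin N) ℂ → Matrix (Fin N) (Fin N) ℂ)
    (hEE : ∀ V A, EE V A = eml (fun i : Idx P => if IsCentral c i then (1 : Matrix (Fin N) (Fin N) ℂ) else V i * star A) * A)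
    (Φ : ((Idx P → Matrix (Fin N) (Fin N) ℂ) × Matrix (Fin N) (Fin N) ℂ) × (specialUnitaryLogChart (Fin N)).lie → (specialUnitaryLogChart (Fin N)).lie)
    (hΦ : ∀ p, Φ p = HaarExpChartLocal.proj (specialUnitaryLogChart (Fin N))
      (mlog (star (EE p.1.1 p.1.2) * EE p.1.1 (p.1.2 * exp ((p.2 : (specialUnitaryLogChart (Fin N)).lie) : Matrix (Fin N) (Fin N) ℂ))))) :
    ContinuousOn (fun p : GaugeField P j (SU N) × SU N => ENNReal.toNNReal (jacDensity (lie_adStable_specialUnitaryGroup (n := Fin N)) (Φ (((fun i => ((openHol p.1 c i : SU N) : Matrix (Fin N) (Fin N) ℂ)), ((openHol p.1 c i₀ : SU N) : Matrix (Fin N) (Fin N) ℂ)), (isChartRep_specialUnitaryGroup (n := Fin N)).logChart ((openHol p.1 c i₀)⁻¹ * (pre p.1 c * p.2 * post p.1 c)))) * ENNReal.ofReal |((fderiv ℝ Φ (((fun i => ((openHol p.1 c i : SU N) : Matrix (Fin N) (Fin N) ℂ)), ((openHol p.1 c i₀ : SU N) : Matrix (Fin N) (Fin N) ℂ)), (isChartRep_specialUnitaryGroup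 (n := Fin N)).logChart ((openHol p.1 c i₀)⁻¹ * (pre p.1 c * p.2 * post p.1 c)))).comp (ContinuousLinearMap.inr ℝ ((Idx P → Matrix (Fin N) (Fin N) ℂ) × Matrix (Fin N) (Fin N) ℂ) (specialUnitaryLogChart (Fin N)).lie)).det| / jacDensity (lie_adStable_specialUnitaryGroup (n := Fin N)) ((isChartRep_specialUnitaryGroup (n := Fin N)).logChart ((openHol p.1 c i₀)⁻¹ * (pre p.1 c * p.2 * post p.1 c)))))
      {p : GaugeField P j (SU N) × SU N | ∀ i : Idx P, dist1 (fibreFamily p.1 c (pre p.1 c * p.2 * post p.1 c) i) ≤ α} := by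
  obtain ⟨h19r, h38s, h19half, h2αδ, h19one⟩ := radii_of_le_deltaSU (N := N) hα0 hα64
  have hαδ : α < deltaSU (Fin N) := by linarith
  have hcont : Continuous fun T : (((Idx P → Matrix (Fin N) (Fin N) ℂ) × Matrix (Fin N) (Fin N) ℂ) × (specialUnitaryLogChart (Fin N)).lie) →L[ℝ] (specialUnitaryLogChart (Fin N)).lie => (T.comp (ContinuousLinearMap.inr ℝ ((Idx P → Matrix (Fin N) (Fin N) ℂ) × Matrix (Fin N) (Fin N) ℂ) (specialUnitaryLogChart (Fin N)).lie)).det :=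
    ContinuousLinearMap.continuous_det.comp ((ContinuousLinearMap.compL ℝ (specialUnitaryLogChart (Fin N)).lie (((Idx P → Matrix (Fin N) (Fin N) ℂ) × Matrix (Fin N) (Fin N) ℂ) × (specialUnitaryLogChart (Fin N)).lie) (specialUnitaryLogChart (Fin N)).lie).flip (ContinuousLinearMap.inr ℝ ((Idx P → Matrix (Fin N) (Fin N) ℂ) × Matrix (Fin N) (Fin N) ℂ) (specialUnitaryLogChart (Fin N)).lie)).continuous
  have hpar : Continuous fun p : GaugeField P j (SU N) × SU N => ((((fun i => ((openHol p.1 c i : SU N) : Matrix (Fin N) (Fin N) ℂ)), ((openHol p.1 c i₀ : SU N) : Matrix (Fin N) (Fin N) ℂ)) : ((Idx P → Matrix (Fin N) (Fin N) ℂ) × Matrix (Fin N) (Fin N) ℂ))) :=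
    (continuous_pi fun i => continuous_subtype_val.comp ((continuous_holAt _).comp continuous_fst)).prodMk (continuous_subtype_val.comp ((continuous_holAt _).comp continuous_fst))
  -- facts at a window point `(U, g)`
  have hwin : ∀ {U : GaugeField P j (SU N)} {g : SU N}, (∀ i : Idx P, dist1 (fibreFamily U c (pre U c * g * post U c) i) ≤ α) →
      ‖fundamentalRep (Fin N) ((openHol U c i₀)⁻¹ * (pre U c * g * post U c)) - 1‖ < innerRadius (specialUnitaryLogChart (Fin N)) := by
    intro U g hg; rw [fundamentalRep_apply, norm_coe_inv_mul_sub_one, norm_sub_rev]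
    exact (norm_openHol_sub_le_of_mem U c hg hi₀).trans_lt (by linarith)
  have hX : ContinuousOn (fun p : GaugeField P j (SU N) × SU N => (isChartRep_specialUnitaryGroup (n := Fin N)).logChart ((openHol p.1 c i₀)⁻¹ * (pre p.1 c * p.2 * post p.1 c)))
      {p : GaugeField P j (SU N) × SU N | ∀ i : Idx P, dist1 (fibreFamily p.1 c (pre p.1 c * p.2 * post p.1 c) i) ≤ α} :=
    (isChartRep_specialUnitaryGroup (n := Fin N)).continuousOn_logChart.comp ((((continuous_holAt _).comp continuous_fst).inv.mul ((((continuous_holAt _).comp continuous_fst).mul continuous_snd).mul ((continuous_holAt _).comp continuous_fst))).continuousOn) fun p hp => hwin hp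
  have hXlt : ∀ {U : GaugeField P j (SU N)} {g : SU N}, (∀ i : Idx P, dist1 (fibreFamily U c (pre U c * g * post U c) i) ≤ α) →
      ‖(isChartRep_specialUnitaryGroup (n := Fin N)).logChart ((openHol U c i₀)⁻¹ * (pre U c * g * post U c))‖ < chartRadius (specialUnitaryLogChart (Fin N)) := by
    intro U g hg
    have hk : (openHol U c i₀)⁻¹ * (pre U c * g * post U c) ∈ (isChartRep_specialUnitaryGroup (n := Fin N)).window (chartRadius (specialUnitaryLogChart (Fin N))) := by
      refine mem_window_of_norm_sub_one_le (t := α) ?_ (by linarith) (by linarith) (by linarith)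
      rw [norm_coe_inv_mul_sub_one, norm_sub_rev]; exact norm_openHol_sub_le_of_mem U c hg hi₀
    exact mem_ball_zero_iff.1 ((isChartRep_specialUnitaryGroup (n := Fin N)).logChart_mem_ball le_rfl hk)
  have hΦd : ∀ {U : GaugeField P j (SU N)} {g : SU N}, (∀ i : Idx P, dist1 (fibreFamily U c (pre U c * g * post U c) i) ≤ α) →
      ContDiffAt ℝ ⊤ Φ (((fun i => ((openHol U c i : SU N) : Matrix (Fin N) (Fin N) ℂ)), ((openHol U c i₀ : SU N) : Matrix (Fin N) (Fin N) ℂ)), (isChartRep_specialUnitaryGroup (n := Fin N)).logChart ((openHol U c i₀)⁻¹ * (pre U c * g * post U c))) := by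
    intro U g hg
    have hWs : FibreSmall (expMeanLogSU (n := Fin N)) U c (pre U c * g * post U c) := fibreSmall_of_mem_window U c hαδ hg
    have hbs : FibreSmall (expMeanLogSU (n := Fin N)) U c (openHol U c i₀) := fibreSmall_openHol_of_mem_window U c hα0 h2αδ hg hi₀
    have hbΘ : openHol U c i₀ * (isChartRep_specialUnitaryGroup (n := Fin N)).expChart ((isChartRep_specialUnitaryGroup (n := Fin N)).logChart ((openHol U c i₀)⁻¹ * (pre U c * g * post U c))) = pre U c * g * post U c := by
      rw [(isChartRep_specialUnitaryGroup (n := Fin N)).expChart_logChart (hwin hg), mul_inv_cancel_left]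
    have hcoe : ((openHol U c i₀ : SU N) : Matrix (Fin N) (Fin N) ℂ) * exp ((((isChartRep_specialUnitaryGroup (n := Fin N)).logChart ((openHol U c i₀)⁻¹ * (pre U c * g * post U c)) : (specialUnitaryLogChart (Fin N)).lie) : (specialUnitaryLogChart (Fin N)).lie) : Matrix (Fin N) (Fin N) ℂ) =
        ((pre U c * g * post U c : SU N) : Matrix (Fin N) (Fin N) ℂ) := by
      rw [← coe_expChart_SU, ← Submonoid.coe_mul, hbΘ]
    refine contDiffAt_modelChart c EE hEE Φ hΦ ?_ ?_ ?_
    · intro i hi; rw [norm_coe_mul_star_sub_one]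
      exact (norm_openHol_sub_openHol_le U c hg hi hi₀).trans_lt (by linarith)
    · intro i hi; rw [hcoe, norm_coe_mul_star_sub_one]; exact (norm_openHol_sub_le_of_mem U c hg hi).trans_lt (by linarith)
    · have hXs : FibreSmall (expMeanLogSU (n := Fin N)) U c (openHol U c i₀ * (isChartRep_specialUnitaryGroup (n := Fin N)).expChart ((isChartRep_specialUnitaryGroup (n := Fin N)).logChart ((openHol U c i₀)⁻¹ * (pre U c * g * post U c)))) := by
        rw [hbΘ]; exact hWs
      rw [star_modelE_mul_modelE_eq_coe U c EE hEE hbs hXs, hbΘ]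
      exact (norm_coe_fibreMap_inv_mul_sub_one_le U c hα0 (by linarith) h2αδ hg hi₀).trans_lt h19one
  -- the real-valued density is jointly continuous on the window graph
  have hR : ContinuousOn (fun p : GaugeField P j (SU N) × SU N =>
      |LinearMap.det (B13HaarSigmaJacobian.jac (lie_adStable_specialUnitaryGroup (n := Fin N)) (Φ (((fun i => ((openHol p.1 c i : SU N) : Matrix (Fin N) (Fin N) ℂ)), ((openHol p.1 c i₀ : SU N) : Matrix (Fin N) (Fin N) ℂ)), (isChartRep_specialUnitaryGroup (n := Fin N)).logChart ((openHol p.1 c i₀)⁻¹ * (pre p.1 c * p.2 * post p.1 c)))) : (specialUnitaryLogChart (Fin N)).lie →ₗ[ℝ] (specialUnitaryLogChart (Fin N)).lie)| *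
        |((fderiv ℝ Φ (((fun i => ((openHol p.1 c i : SU N) : Matrix (Fin N) (Fin N) ℂ)), ((openHol p.1 c i₀ : SU N) : Matrix (Fin N) (Fin N) ℂ)), (isChartRep_specialUnitaryGroup (n := Fin N)).logChart ((openHol p.1 c i₀)⁻¹ * (pre p.1 c * p.2 * post p.1 c)))).comp (ContinuousLinearMap.inr ℝ ((Idx P → Matrix (Fin N) (Fin N) ℂ) × Matrix (Fin N) (Fin N) ℂ) (specialUnitaryLogChart (Fin N)).lie)).det| /
        |LinearMap.det (B13HaarSigmaJacobian.jac (lie_adStable_specialUnitaryGroup (n := Fin N)) ((isChartRep_specialUnitaryGroup (n := Fin N)).logChart ((openHol p.1 c i₀)⁻¹ * (pre p.1 c * p.2 * post p.1 c))) : (specialUnitaryLogChart (Fin N)).lie →ₗ[ℝ] (specialUnitaryLogChart (Fin N)).lie)|)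
      {p : GaugeField P j (SU N) × SU N | ∀ i : Idx P, dist1 (fibreFamily p.1 c (pre p.1 c * p.2 * post p.1 c) i) ≤ α} := by
    intro p hp
    have hq : ContinuousWithinAt (fun p : GaugeField P j (SU N) × SU N => ((((fun i => ((openHol p.1 c i : SU N) : Matrix (Fin N) (Fin N) ℂ)), ((openHol p.1 c i₀ : SU N) : Matrix (Fin N) (Fin N) ℂ)) : ((Idx P → Matrix (Fin N) (Fin N) ℂ) × Matrix (Fin N) (Fin N) ℂ)), (isChartRep_specialUnitaryGroup (n := Fin N)).logChart ((openHol p.1 c i₀)⁻¹ * (pre p.1 c * p.2 * post p.1 c))))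
        {p : GaugeField P j (SU N) × SU N | ∀ i : Idx P, dist1 (fibreFamily p.1 c (pre p.1 c * p.2 * post p.1 c) i) ≤ α} p := hpar.continuousWithinAt.prodMk (hX p hp)
    have hΦg : ContinuousWithinAt (fun p : GaugeField P j (SU N) × SU N => Φ (((fun i => ((openHol p.1 c i : SU N) : Matrix (Fin N) (Fin N) ℂ)), ((openHol p.1 c i₀ : SU N) : Matrix (Fin N) (Fin N) ℂ)), (isChartRep_specialUnitaryGroup (n := Fin N)).logChart ((openHol p.1 c i₀)⁻¹ * (pre p.1 c * p.2 * post p.1 c)))) {p : GaugeField P j (SU N) × SU N | ∀ i : Idx P, dist1 (fibreFamily p.1 c (pre p.1 c * p.2 * post p.1 c) i) ≤ α} p :=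
      ContinuousAt.comp_continuousWithinAt (g := Φ) (f := fun p : GaugeField P j (SU N) × SU N => ((((fun i => ((openHol p.1 c i : SU N) : Matrix (Fin N) (Fin N) ℂ)), ((openHol p.1 c i₀ : SU N) : Matrix (Fin N) (Fin N) ℂ)) : ((Idx P → Matrix (Fin N) (Fin N) ℂ) × Matrix (Fin N) (Fin N) ℂ)), (isChartRep_specialUnitaryGroup (n := Fin N)).logChart ((openHol p.1 c i₀)⁻¹ * (pre p.1 c * p.2 * post p.1 c)))) (hΦd hp).continuousAt hq
    have hDg : ContinuousWithinAt (fun p : GaugeField P j (SU N) × SU N => fderiv ℝ Φ (((fun i => ((openHol p.1 c i : SU N) : Matrix (Fin N) (Fin N) ℂ)), ((openHol p.1 c i₀ : SU N) : Matrix (Fin N) (Fin N) ℂ)), (isChartRep_specialUnitaryGroup (n := Fin N)).logChart ((openHol p.1 c i₀)⁻¹ * (pre p.1 c * p.2 * post p.1 c)))) {p : GaugeField P j (SU N) × SU N | ∀ i : Idx P, dist1 (fibreFamily p.1 c (pre p.1 c * p.2 * post p.1 c) i) ≤ α} p :=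
      ContinuousAt.comp_continuousWithinAt (g := fderiv ℝ Φ) (f := fun p : GaugeField P j (SU N) × SU N => ((((fun i => ((openHol p.1 c i : SU N) : Matrix (Fin N) (Fin N) ℂ)), ((openHol p.1 c i₀ : SU N) : Matrix (Fin N) (Fin N) ℂ)) : ((Idx P → Matrix (Fin N) (Fin N) ℂ) × Matrix (Fin N) (Fin N) ℂ)), (isChartRep_specialUnitaryGroup (n := Fin N)).logChart ((openHol p.1 c i₀)⁻¹ * (pre p.1 c * p.2 * post p.1 c)))) ((hΦd hp).continuousAt_fderiv (by simp)) hq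
    have ha := ContinuousAt.comp_continuousWithinAt (g := fun x : (specialUnitaryLogChart (Fin N)).lie => |LinearMap.det (B13HaarSigmaJacobian.jac (lie_adStable_specialUnitaryGroup (n := Fin N)) x : (specialUnitaryLogChart (Fin N)).lie →ₗ[ℝ] (specialUnitaryLogChart (Fin N)).lie)|)
      (f := fun p : GaugeField P j (SU N) × SU N => Φ (((fun i => ((openHol p.1 c i : SU N) : Matrix (Fin N) (Fin N) ℂ)), ((openHol p.1 c i₀ : SU N) : Matrix (Fin N) (Fin N) ℂ)), (isChartRep_specialUnitaryGroup (n := Fin N)).logChart ((openHol p.1 c i₀)⁻¹ * (pre p.1 c * p.2 * post p.1 c)))) ((continuous_abs.comp (continuous_det_jac (lie_adStable_specialUnitaryGroup (n := Fin N)))).continuousAt) hΦg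
    have hd := ContinuousAt.comp_continuousWithinAt (g := fun T : (((Idx P → Matrix (Fin N) (Fin N) ℂ) × Matrix (Fin N) (Fin N) ℂ) × (specialUnitaryLogChart (Fin N)).lie) →L[ℝ] (specialUnitaryLogChart (Fin N)).lie => |(T.comp (ContinuousLinearMap.inr ℝ ((Idx P → Matrix (Fin N) (Fin N) ℂ) × Matrix (Fin N) (Fin N) ℂ) (specialUnitaryLogChart (Fin N)).lie)).det|)
      (f := fun p : GaugeField P j (SU N) × SU N => fderiv ℝ Φ (((fun i => ((openHol p.1 c i : SU N) : Matrix (Fin N) (Fin N) ℂ)), ((openHol p.1 c i₀ : SU N) : Matrix (Fin N) (Fin N) ℂ)), (isChartRep_specialUnitaryGroup (n := Fin N)).logChart ((openHol p.1 c i₀)⁻¹ * (pre p.1 c * p.2 * post p.1 c)))) ((continuous_abs.comp hcont).continuousAt) hDg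
    have he := ContinuousAt.comp_continuousWithinAt (g := fun x : (specialUnitaryLogChart (Fin N)).lie => |LinearMap.det (B13HaarSigmaJacobian.jac (lie_adStable_specialUnitaryGroup (n := Fin N)) x : (specialUnitaryLogChart (Fin N)).lie →ₗ[ℝ] (specialUnitaryLogChart (Fin N)).lie)|)
      (f := fun p : GaugeField P j (SU N) × SU N => (isChartRep_specialUnitaryGroup (n := Fin N)).logChart ((openHol p.1 c i₀)⁻¹ * (pre p.1 c * p.2 * post p.1 c))) ((continuous_abs.comp (continuous_det_jac (lie_adStable_specialUnitaryGroup (n := Fin N)))).continuousAt) (hX p hp)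
    have hne : |LinearMap.det (B13HaarSigmaJacobian.jac (lie_adStable_specialUnitaryGroup (n := Fin N)) ((isChartRep_specialUnitaryGroup (n := Fin N)).logChart ((openHol p.1 c i₀)⁻¹ * (pre p.1 c * p.2 * post p.1 c))) : (specialUnitaryLogChart (Fin N)).lie →ₗ[ℝ] (specialUnitaryLogChart (Fin N)).lie)| ≠ 0 :=
      abs_ne_zero.2 (det_jac_ne_zero_of_norm_le_half (lie_adStable_specialUnitaryGroup (n := Fin N)) (((hXlt hp).le.trans chartRadius_le_innerRadius).trans innerRadius_le_half))
    exact (ha.mul hd).div he hne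
  refine (continuous_real_toNNReal.comp_continuousOn hR).congr fun p hp => ?_
  have hpos : 0 < |LinearMap.det (B13HaarSigmaJacobian.jac (lie_adStable_specialUnitaryGroup (n := Fin N)) ((isChartRep_specialUnitaryGroup (n := Fin N)).logChart ((openHol p.1 c i₀)⁻¹ * (pre p.1 c * p.2 * post p.1 c))) : (specialUnitaryLogChart (Fin N)).lie →ₗ[ℝ] (specialUnitaryLogChart (Fin N)).lie)| :=
    abs_pos.2 (det_jac_ne_zero_of_norm_le_half (lie_adStable_specialUnitaryGroup (n := Fin N)) (((hXlt hp).le.trans chartRadius_le_innerRadius).trans innerRadius_le_half))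
  show ENNReal.toNNReal _ = Real.toNNReal _
  rw [jacDensity_def, jacDensity_def, ← ENNReal.ofReal_mul (abs_nonneg _), ← ENNReal.ofReal_div_of_pos hpos, ENNReal.ofReal, ENNReal.toNNReal_coe]


end Graph

/-! ## §2  (F) with the fifth clause: joint continuity on the window graph -/

section Package

/-- §2 ★★★ **(F) WITH JOINT CONTINUITY ON THE WINDOW GRAPH** — dag-n09-w4 g5's `exists_jacobian_forwardLaws_continuousOn` (same witness: the chart Jacobian at a bond with an
off-central index, `1` at an all-central bond) with a FIFTH exported clause `∀ c, ContinuousOn (fun p => jac c p.1 p.2) {(U, g) | g ∈ Ωα c U}` (§1 + `jacobianMeas_eq_of_mem` on the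
graph); the four old clauses by the same proofs (`measurable_jacobianMeas`, `jacobian_ne_zero_and_ne_top_of_mem`, `forwardLaw_avgFun_update_centralWindow`, `forwardLaw_of_allCentral`,
`continuousOn_jacobian_toNNReal` BY NAME).  `j + 1 ≤ m + K`, `0 ≤ α ≤ 1∕24`, `64·α ≤ δ_N`, `157·α < L^{−(d−1)}`, `offCard c∕|Idx| + 150·α < 1`.
[cite: Balaban1987RG1, (0.4) p.253 and (2.10) p.267; Helgason2000, Ch. I §1 Thm. 1.14 (12)-(13) p. 96] -/
theorem exists_jacobian_forwardLaws_continuousOn_graph (hj : j + 1 ≤ P.m + P.K) {α : ℝ} (hα0 : 0 ≤ α) (hα24 : α ≤ 1 / 24) (hα64 : 64 * α ≤ deltaSU (Fin N))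
    (hαL : 157 * α < ((P.L : ℝ) ^ (P.d - 1))⁻¹) (hgap : ∀ c : PBond P (j + 1), (offCard c : ℝ) / (Fintype.card (Idx P) : ℝ) + 150 * α < 1) :
    ∃ jac : PBond P (j + 1) → GaugeField P j (SU N) → SU N → ℝ≥0,
      (∀ c, Measurable fun p : GaugeField P j (SU N) × SU N => jac c p.1 p.2) ∧
      (∀ c U g, (∀ i : Idx P, dist1 (fibreFamily U c (pre U c * g * post U c) i) ≤ α) → jac c U g ≠ 0) ∧
      (∀ c U, (HaarData.haar : Measure (SU N)).restrict ((fun g : SU N => avgFun (expMeanLogSU (n := Fin N)) (update U (centralBond c) g) c) '' {g : SU N | ∀ i : Idx P, dist1 (fibreFamily U c (pre U c * g * post U c) i) ≤ α}) =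
        Measure.map (fun g : SU N => avgFun (expMeanLogSU (n := Fin N)) (update U (centralBond c) g) c) (((HaarData.haar : Measure (SU N)).restrict {g : SU N | ∀ i : Idx P, dist1 (fibreFamily U c (pre U c * g * post U c) i) ≤ α}).withDensity fun g => (jac c U g : ℝ≥0∞))) ∧
      (∀ c U, ContinuousOn (jac c U) {g : SU N | ∀ i : Idx P, dist1 (fibreFamily U c (pre U c * g * post U c) i) ≤ α}) ∧
      (∀ c, ContinuousOn (fun p : GaugeField P j (SU N) × SU N => jac c p.1 p.2) {p : GaugeField P j (SU N) × SU N | ∀ i : Idx P, dist1 (fibreFamily p.1 c (pre p.1 c * p.2 * post p.1 c) i) ≤ α}) := by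
  classical
  letI : MeasurableSpace (specialUnitaryLogChart (Fin N)).lie := borel _
  haveI : BorelSpace (specialUnitaryLogChart (Fin N)).lie := ⟨rfl⟩
  obtain ⟨jac, hjac⟩ : ∃ jac : PBond P (j + 1) → GaugeField P j (SU N) → SU N → ℝ≥0, ∀ c, jac c =
      (if hc : (∃ i : Idx P, ¬ IsCentral c i) then
      (fun U g => ENNReal.toNNReal (jacDensity (lie_adStable_specialUnitaryGroup (n := Fin N)) ((isChartRep_specialUnitaryGroup (n := Fin N)).logChart ((avgFun (expMeanLogSU (n := Fin N)) (update U (centralBond c) ((pre U c)⁻¹ * openHol U c hc.choose * (post U c)⁻¹)) c)⁻¹ * avgFun (expMeanLogSU (n := Fin N)) (update U (centralBond c) g) c)) * ENNReal.ofReal |((fderiv ℝ (fun p : ((Idx P → Matrix (Fin N) (Fin N) ℂ) × Matrix (Fin N) (Fin N) ℂ) × (specialUnitaryLogChart (Fin N)).lie => HaarExpChartLocal.proj (specialUnitaryLogChart (Fin N)) (mlog (star ((fun (V : Idx P → Matrix (Fin N) (Fin N) ℂ) (A : Matrix (Fin N) (Fin N) ℂ) => eml (fun i : Idx P => if IsCentral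 c i then (1 : Matrix (Fin N) (Fin N) ℂ) else V i * star A) * A) p.1.1 p.1.2) * (fun (V : Idx P → Matrix (Fin N) (Fin N) ℂ) (A : Matrix (Fin N) (Fin N) ℂ) => eml (fun i : Idx P => if IsCentral c i then (1 : Matrix (Fin N) (Fin N) ℂ) else V i * star A) * A) p.1.1 (p.1.2 * exp ((p.2 : (specialUnitaryLogChart (Fin N)).lie) : Matrix (Fin N) (Fin N) ℂ))))) (((fun i => ((openHol U c i : SU N) : Matrix (Fin N) (Fin N) ℂ)), ((openHol U c hc.choose : SU N) : Matrix (Fin N) (Fin N) ℂ)), (isChartRep_specialUnitaryGroup (n := Fin N)).logChart ((openHol U c hc.choose)⁻¹ * (pre U c * g * post U c)))).comp (ContinuousLinearMap.inr ℝ ((Idx P → Matrix (Fin N) (Fin N) ℂ) × Matrix (Fin N) (Fin N) ℂ) (specialUnitaryLogChart (Fin N)).lie)).det| / jacDensity (lie_adStable_specialUnitaryGroup (n := Fin N)) ((isChartRep_specialUnitaryGroup (n := Fin N)).logChart ((openHol U c hc.choose)⁻¹ * (pre U c * g * post U c)))))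
    else fun _ _ => 1) := ⟨_, fun c => rfl⟩
  refine ⟨jac, ?_, ?_, ?_, ?_, ?_⟩
  · intro c
    by_cases hc : ∃ i : Idx P, ¬ IsCentral c i
    · rw [hjac c, dif_pos hc]
      exact (measurable_jacobianMeas (N := N) c hc.choose).ennreal_toNNReal
    · rw [hjac c, dif_neg hc]; exact measurable_const
  · intro c U g hg
    by_cases hc : ∃ i : Idx P, ¬ IsCentral c i
    · rw [hjac c, dif_pos hc]
      have hne := jacobian_ne_zero_and_ne_top_of_mem hj U c hα0 hα24 hα64 hαL hc.choose_spec (fun (V : Idx P → Matrix (Fin N) (Fin N) ℂ) (A : Matrix (Fin N) (Fin N) ℂ) => eml (fun i : Idx P => if IsCentral c i then (1 : Matrix (Fin N) (Fin N) ℂ) else V i * star A) * A) (fun _ _ => rfl) (fun p : ((Idx P → Matrix (Fin N) (Fin N) ℂ) × Matrix (Fin N) (Fin N) ℂ) × (specialUnitaryLogChart (Fin N)).lie => HaarExpChartLocal.proj (specialUnitaryLogChart (Fin N)) (mlog (star ((fun (V : Idx P → Matrix (Fin N) (Fin N) ℂ) (A : Matrix (Fin N) (Fin N) ℂ) => eml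 (fun i : Idx P => if IsCentral c i then (1 : Matrix (Fin N) (Fin N) ℂ) else V i * star A) * A) p.1.1 p.1.2) * (fun (V : Idx P → Matrix (Fin N) (Fin N) ℂ) (A : Matrix (Fin N) (Fin N) ℂ) => eml (fun i : Idx P => if IsCentral c i then (1 : Matrix (Fin N) (Fin N) ℂ) else V i * star A) * A) p.1.1 (p.1.2 * exp ((p.2 : (specialUnitaryLogChart (Fin N)).lie) : Matrix (Fin N) (Fin N) ℂ))))) (fun _ => rfl) hg
      have heq := jacobianMeas_eq_of_mem hj U c hα0 hα64 hc.choose_spec (fun (V : Idx P → Matrix (Fin N) (Fin N) ℂ) (A : Matrix (Fin N) (Fin N) ℂ) => eml (fun i : Idx P => if IsCentral c i then (1 : Matrix (Fin N) (Fin N) ℂ) else V i * star A) * A) (fun _ _ => rfl) (fun p : ((Idx P → Matrix (Fin N) (Fin N) ℂ) × Matrix (Fin N) (Fin N) ℂ) × (specialUnitaryLogChart (Fin N)).lie => HaarExpChartLocal.proj (specialUnitaryLogChart (Fin N)) (mlog (star ((fun (V : Idx P → Matrix (Fin N) (Fin N) ℂ) (A : Matrix (Fin N) (Fin N) ℂ)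 => eml (fun i : Idx P => if IsCentral c i then (1 : Matrix (Fin N) (Fin N) ℂ) else V i * star A) * A) p.1.1 p.1.2) * (fun (V : Idx P → Matrix (Fin N) (Fin N) ℂ) (A : Matrix (Fin N) (Fin N) ℂ) => eml (fun i : Idx P => if IsCentral c i then (1 : Matrix (Fin N) (Fin N) ℂ) else V i * star A) * A) p.1.1 (p.1.2 * exp ((p.2 : (specialUnitaryLogChart (Fin N)).lie) : Matrix (Fin N) (Fin N) ℂ))))) (fun _ => rfl) hg
      show ENNReal.toNNReal _ ≠ 0
      rw [heq, Ne, ENNReal.toNNReal_eq_zero_iff, not_or]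
      exact hne
    · rw [hjac c, dif_neg hc]; exact one_ne_zero
  · intro c U
    by_cases hc : ∃ i : Idx P, ¬ IsCentral c i
    · rw [hjac c, dif_pos hc]
      have hlaw := forwardLaw_avgFun_update_centralWindow hj U c hα0 hα24 hα64 (hgap c) hc.choose_spec (fun (V : Idx P → Matrix (Fin N) (Fin N) ℂ) (A : Matrix (Fin N) (Fin N) ℂ) => eml (fun i : Idx P => if IsCentral c i then (1 : Matrix (Fin N) (Fin N) ℂ) else V i * star A) * A) (fun _ _ => rfl) (fun p : ((Idx P → Matrix (Fin N) (Fin N) ℂ) × Matrix (Fin N) (Fin N) ℂ) × (specialUnitaryLogChart (Fin N)).lie => HaarExpChartLocal.proj (specialUnitaryLogChart (Fin N)) (mlog (star ((fun (V : Idx P → Matrix (Fin N) (Fin N) ℂ) (A : Matrix (Fin N) (Fin N) ℂ) => eml (fun i : Idx P => if IsCentral c i then (1 : Matrix (Fin N) (Fin N) ℂ) else V i * star A) * A) p.1.1 p.1.2) * (fun (V : Idx P → Matrix (Fin N) (Fin N) ℂ) (A : Matrix (Fin N) (Fin N) ℂ) => eml (fun i : Idx P => if IsCentral c i then (1 : Matrix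 (Fin N) (Fin N) ℂ) else V i * star A) * A) p.1.1 (p.1.2 * exp ((p.2 : (specialUnitaryLogChart (Fin N)).lie) : Matrix (Fin N) (Fin N) ℂ))))) (fun _ => rfl)
      rw [hlaw]
      congr 1
      refine withDensity_congr_ae ?_
      have hΩm : MeasurableSet {g : SU N | ∀ i : Idx P, dist1 (fibreFamily U c (pre U c * g * post U c) i) ≤ α} :=
        ((isClosed_centralWindowW U c α).preimage ((continuous_const.mul continuous_id).mul continuous_const)).measurableSet
      refine (ae_restrict_iff' hΩm).2 (Filter.Eventually.of_forall fun g hg => ?_)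
      have hne := jacobian_ne_zero_and_ne_top_of_mem hj U c hα0 hα24 hα64 hαL hc.choose_spec (fun (V : Idx P → Matrix (Fin N) (Fin N) ℂ) (A : Matrix (Fin N) (Fin N) ℂ) => eml (fun i : Idx P => if IsCentral c i then (1 : Matrix (Fin N) (Fin N) ℂ) else V i * star A) * A) (fun _ _ => rfl) (fun p : ((Idx P → Matrix (Fin N) (Fin N) ℂ) × Matrix (Fin N) (Fin N) ℂ) × (specialUnitaryLogChart (Fin N)).lie => HaarExpChartLocal.proj (specialUnitaryLogChart (Fin N)) (mlog (star ((fun (V : Idx P → Matrix (Fin N) (Fin N) ℂ) (A : Matrix (Fin N) (Fin N) ℂ) => eml (fun i : Idx P => if IsCentral c i then (1 : Matrix (Fin N) (Fin N) ℂ) else V i * star A) * A) p.1.1 p.1.2) * (fun (V : Idx P → Matrix (Fin N) (Fin N) ℂ) (A : Matrix (Fin N) (Fin N) ℂ) => eml (fun i : Idx P => if IsCentral c i then (1 : Matrix (Fin N) (Fin N) ℂ) else V i * star A) * A) p.1.1 (p.1.2 * exp ((p.2 : (specialUnitaryLogChart (Fin N)).lie) : Matrix (Fin N) (Fin N) ℂ)))))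 (fun _ => rfl) hg
      have heq := jacobianMeas_eq_of_mem hj U c hα0 hα64 hc.choose_spec (fun (V : Idx P → Matrix (Fin N) (Fin N) ℂ) (A : Matrix (Fin N) (Fin N) ℂ) => eml (fun i : Idx P => if IsCentral c i then (1 : Matrix (Fin N) (Fin N) ℂ) else V i * star A) * A) (fun _ _ => rfl) (fun p : ((Idx P → Matrix (Fin N) (Fin N) ℂ) × Matrix (Fin N) (Fin N) ℂ) × (specialUnitaryLogChart (Fin N)).lie => HaarExpChartLocal.proj (specialUnitaryLogChart (Fin N)) (mlog (star ((fun (V : Idx P → Matrix (Fin N) (Fin N) ℂ) (A : Matrix (Fin N) (Fin N) ℂ) => eml (fun i : Idx P => if IsCentral c i then (1 : Matrix (Fin N) (Fin N) ℂ) else V i * star A) * A) p.1.1 p.1.2) * (fun (V : Idx P → Matrix (Fin N) (Fin N) ℂ) (A : Matrix (Fin N) (Fin N) ℂ) => eml (fun i : Idx P => if IsCentral c i then (1 : Matrix (Fin N) (Fin N) ℂ) else V i * star A) * A) p.1.1 (p.1.2 * exp ((p.2 : (specialUnitaryLogChart (Fin N)).lie) : Matrix (Fin N) (Fin N) ℂ)))))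 (fun _ => rfl) hg
      show _ = ((ENNReal.toNNReal _ : ℝ≥0) : ℝ≥0∞)
      rw [heq, ENNReal.coe_toNNReal hne.2]
    · rw [hjac c, dif_neg hc]
      have hall : ∀ i : Idx P, IsCentral c i := fun i => by by_contra h; exact hc ⟨i, h⟩
      exact forwardLaw_of_allCentral hj U c hall hα0
  · intro c U
    by_cases hc : ∃ i : Idx P, ¬ IsCentral c i
    · rw [hjac c, dif_pos hc]
      refine (continuousOn_jacobian_toNNReal U c hα0 hα64 hc.choose_spec (fun (V : Idx P → Matrix (Fin N) (Fin N) ℂ) (A : Matrix (Fin N) (Fin N) ℂ) => eml (fun i : Idx P => if IsCentral c i then (1 : Matrix (Fin N) (Fin N) ℂ) else V i * star A) * A) (fun _ _ => rfl) (fun p : ((Idx P → Matrix (Fin N) (Fin N) ℂ) × Matrix (Fin N) (Fin N) ℂ) × (specialUnitaryLogChart (Fin N)).lie => HaarExpChartLocal.proj (specialUnitaryLogChart (Fin N)) (mlog (star ((fun (V : Idx P → Matrix (Fin N) (Fin N) ℂ) (A : Matrix (Fin N) (Fin N) ℂ) => eml (fun i : Idx P => if IsCentral c i then (1 : Matrix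 (Fin N) (Fin N) ℂ) else V i * star A) * A) p.1.1 p.1.2) * (fun (V : Idx P → Matrix (Fin N) (Fin N) ℂ) (A : Matrix (Fin N) (Fin N) ℂ) => eml (fun i : Idx P => if IsCentral c i then (1 : Matrix (Fin N) (Fin N) ℂ) else V i * star A) * A) p.1.1 (p.1.2 * exp ((p.2 : (specialUnitaryLogChart (Fin N)).lie) : Matrix (Fin N) (Fin N) ℂ))))) (fun _ => rfl)).congr fun g hg => ?_
      exact congrArg ENNReal.toNNReal (jacobianMeas_eq_of_mem hj U c hα0 hα64 hc.choose_spec (fun (V : Idx P → Matrix (Fin N) (Fin N) ℂ) (A : Matrix (Fin N) (Fin N) ℂ) => eml (fun i : Idx P => if IsCentral c i then (1 : Matrix (Fin N) (Fin N) ℂ) else V i * star A) * A) (fun _ _ => rfl) (fun p : ((Idx P → Matrix (Fin N) (Fin N) ℂ) × Matrix (Fin N) (Fin N) ℂ) × (specialUnitaryLogChart (Fin N)).lie => HaarExpChartLocal.proj (specialUnitaryLogChart (Fin N)) (mlog (star ((fun (V : Idx P → Matrix (Fin N) (Fin N) ℂ) (A : Matrix (Fin N) (Fin N) ℂ) =>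 eml (fun i : Idx P => if IsCentral c i then (1 : Matrix (Fin N) (Fin N) ℂ) else V i * star A) * A) p.1.1 p.1.2) * (fun (V : Idx P → Matrix (Fin N) (Fin N) ℂ) (A : Matrix (Fin N) (Fin N) ℂ) => eml (fun i : Idx P => if IsCentral c i then (1 : Matrix (Fin N) (Fin N) ℂ) else V i * star A) * A) p.1.1 (p.1.2 * exp ((p.2 : (specialUnitaryLogChart (Fin N)).lie) : Matrix (Fin N) (Fin N) ℂ))))) (fun _ => rfl) hg)
    · rw [hjac c, dif_neg hc]; exact continuousOn_const
  · intro c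
    by_cases hc : ∃ i : Idx P, ¬ IsCentral c i
    · rw [hjac c, dif_pos hc]
      refine (continuousOn_jacobianFormula_graph c hα0 hα64 hc.choose_spec (fun (V : Idx P → Matrix (Fin N) (Fin N) ℂ) (A : Matrix (Fin N) (Fin N) ℂ) => eml (fun i : Idx P => if IsCentral c i then (1 : Matrix (Fin N) (Fin N) ℂ) else V i * star A) * A) (fun _ _ => rfl) (fun p : ((Idx P → Matrix (Fin N) (Fin N) ℂ) × Matrix (Fin N) (Fin N) ℂ) × (specialUnitaryLogChart (Fin N)).lie => HaarExpChartLocal.proj (specialUnitaryLogChart (Fin N)) (mlog (star ((fun (V : Idx P → Matrix (Fin N) (Fin N) ℂ) (A : Matrix (Fin N) (Fin N) ℂ) => eml (fun i : Idx P => if IsCentral c i then (1 : Matrix (Fin N) (Fin N) ℂ) else V i * star A) * A) p.1.1 p.1.2) * (fun (V : Idx P → Matrix (Fin N) (Fin N) ℂ) (A : Matrix (Fin N) (Fin N) ℂ) => eml (fun i : Idx P => if IsCentral c i then (1 : Matrix (Fin N) (Fin N) ℂ) else V i * star A) * A) p.1.1 (p.1.2 * exp ((p.2 : (specialUnitaryLogChart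 (Fin N)).lie) : Matrix (Fin N) (Fin N) ℂ))))) (fun _ => rfl)).congr fun p hp => ?_
      exact congrArg ENNReal.toNNReal (jacobianMeas_eq_of_mem hj p.1 c hα0 hα64 hc.choose_spec (fun (V : Idx P → Matrix (Fin N) (Fin N) ℂ) (A : Matrix (Fin N) (Fin N) ℂ) => eml (fun i : Idx P => if IsCentral c i then (1 : Matrix (Fin N) (Fin N) ℂ) else V i * star A) * A) (fun _ _ => rfl) (fun p : ((Idx P → Matrix (Fin N) (Fin N) ℂ) × Matrix (Fin N) (Fin N) ℂ) × (specialUnitaryLogChart (Fin N)).lie => HaarExpChartLocal.proj (specialUnitaryLogChart (Fin N)) (mlog (star ((fun (V : Idx P → Matrix (Fin N) (Fin N) ℂ) (A : Matrix (Fin N) (Fin N) ℂ) => eml (fun i : Idx P => if IsCentral c i then (1 : Matrix (Fin N) (Fin N) ℂ) else V i * star A) * A) p.1.1 p.1.2) * (fun (V : Idx P → Matrix (Fin N) (Fin N) ℂ) (A : Matrix (Fin N) (Fin N) ℂ) => eml (fun i : Idx P => if IsCentral c i then (1 : Matrix (Fin N) (Fin N) ℂ) else V i * star A) * A) p.1.1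 (p.1.2 * exp ((p.2 : (specialUnitaryLogChart (Fin N)).lie) : Matrix (Fin N) (Fin N) ℂ))))) (fun _ => rfl) hp)
    · rw [hjac c, dif_neg hc]; exact continuousOn_const

end Package

/-! ## §3  At the record: the `jac`-letters of road A′'s tower from forward laws, supplied for all `j < K` -/

section Record

variable {F : T4Family}

/-- §3 ★★★ **THE `jac`-LETTERS OF `hreg_pos_all_of_forwardLaws_of_openness`, SUPPLIED** (dag-n09-w5 g5, p636542): on the `K`-th torus, for `0 ≤ α ≤ 1∕24`, `64·α ≤ δ_N`,
`157·α < L^{−(d−1)}` and `∀ j < K, ∀ c, offCard c∕|Idx| + 150·α < 1`, ONE family `jac j c U g` with, for every `j < K`: joint measurability (`hjacm`), a positive lower bound UNIFORM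
on the window graph (`hjaclb`, from §2's fifth clause, `hjac0`, and the compact graph via `exists_pos_le_density_of_continuousOn_graph`), fibrewise continuity (`hjacc`) and the
forward laws of `g ↦ (avOfRecord F N K j).avg (U[β c ↦ g]) c` on the closed `α`-windows (`hfwd`).  CONDITIONAL on the displayed smallness∕gap numerics; nothing of Bałaban's asserted.
[cite: Balaban1987RG1, (0.4) p.253, (2.9) p.266 and (2.10) p.267; Helgason2000, Ch. I §1 Thm. 1.14 (12)-(13) p. 96] -/
theorem exists_jacobianLetters_record (K : ℕ) {α : ℝ} (hα0 : 0 ≤ α) (hα24 : α ≤ 1 / 24) (hα64 : 64 * α ≤ deltaSU (Fin N))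
    (hαL : 157 * α < (((F.P K).L : ℝ) ^ ((F.P K).d - 1))⁻¹)
    (hgap : ∀ j < K, ∀ c : PBond (F.P K) (j + 1), (offCard c : ℝ) / (Fintype.card (Idx (F.P K)) : ℝ) + 150 * α < 1) :
    ∃ jac : ∀ j, PBond (F.P K) (j + 1) → GaugeField (F.P K) j (SU N) → SU N → ℝ≥0,
      (∀ j < K, ∀ c, Measurable fun p : GaugeField (F.P K) j (SU N) × SU N => jac j c p.1 p.2) ∧
      (∀ j < K, ∀ c : PBond (F.P K) (j + 1), ∃ m : ℝ≥0, 0 < m ∧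
        ∀ U g, (∀ i : Idx (F.P K), dist1 (fibreFamily U c (pre U c * g * post U c) i) ≤ α) → m ≤ jac j c U g) ∧
      (∀ j < K, ∀ c U, ContinuousOn (jac j c U) {g : SU N | ∀ i : Idx (F.P K), dist1 (fibreFamily U c (pre U c * g * post U c) i) ≤ α}) ∧
      (∀ j < K, ∀ c U, (HaarData.haar : Measure (SU N)).restrict
          ((fun g => (avOfRecord F N K j).avg (update U (centralBond c) g) c) ''
            {g : SU N | ∀ i : Idx (F.P K), dist1 (fibreFamily U c (pre U c * g * post U c) i) ≤ α}) =
        (((HaarData.haar : Measure (SU N)).restrict {g : SU N | ∀ i : Idx (F.P K), dist1 (fibreFamily U c (pre U c * g * post U c) i) ≤ α}).withDensity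
            fun g => (jac j c U g : ℝ≥0∞)).map (fun g => (avOfRecord F N K j).avg (update U (centralBond c) g) c)) := by
  have hlev : ∀ j, j < K → ∃ jac : PBond (F.P K) (j + 1) → GaugeField (F.P K) j (SU N) → SU N → ℝ≥0,
      (∀ c, Measurable fun p : GaugeField (F.P K) j (SU N) × SU N => jac c p.1 p.2) ∧
      (∀ c U g, (∀ i : Idx (F.P K), dist1 (fibreFamily U c (pre U c * g * post U c) i) ≤ α) → jac c U g ≠ 0) ∧
      (∀ c U, (HaarData.haar : Measure (SU N)).restrict ((fun g : SU N => avgFun (expMeanLogSU (n := Fin N)) (update U (centralBond c) g) c) ''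
          {g : SU N | ∀ i : Idx (F.P K), dist1 (fibreFamily U c (pre U c * g * post U c) i) ≤ α}) =
        Measure.map (fun g : SU N => avgFun (expMeanLogSU (n := Fin N)) (update U (centralBond c) g) c)
          (((HaarData.haar : Measure (SU N)).restrict {g : SU N | ∀ i : Idx (F.P K), dist1 (fibreFamily U c (pre U c * g * post U c) i) ≤ α}).withDensity
            fun g => (jac c U g : ℝ≥0∞))) ∧
      (∀ c U, ContinuousOn (jac c U) {g : SU N | ∀ i : Idx (F.P K), dist1 (fibreFamily U c (pre U c * g * post U c) i) ≤ α}) ∧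
      (∀ c, ContinuousOn (fun p : GaugeField (F.P K) j (SU N) × SU N => jac c p.1 p.2)
        {p : GaugeField (F.P K) j (SU N) × SU N | ∀ i : Idx (F.P K), dist1 (fibreFamily p.1 c (pre p.1 c * p.2 * post p.1 c) i) ≤ α}) :=
    fun j hj => exists_jacobian_forwardLaws_continuousOn_graph (P := F.P K) (succ_le_range_of_lt hj) hα0 hα24 hα64 hαL (hgap j hj)
  choose! jac hm h0 hfwd hc hcg using hlev
  refine ⟨jac, hm, fun j hj c => exists_pos_le_density_of_continuousOn_graph c α (jac j c) (hcg j hj c) (h0 j hj c),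
    fun j hj c U => hc j hj c U, fun j hj c U => ?_⟩
  rw [avOfRecord_avg]
  exact hfwd j hj c U

end Record

end Summit.QuantumFields.YangMills.BalabanUVNodes.N09CentralWindowJacobianGraphContinuous

end
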